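import Literature.Analysis.FluidPDE.RusinSverakSingularityStabilityEpsilon
import Literature.Analysis.FluidPDE.CKNLocalRegularityRRSPressure
import HarnessLib

/-!
# Backward-cylinder boundedness makes an interior point regular: discharge of the bridge **B**
`isRegularPoint_of_eLpNorm_parabolicCylinder_lt_top`

Analysis/FluidPDE proof file (no definitions, no named facts) **discharging the named fact B**
`Literature.Analysis.FluidPDE.isRegularPoint_of_eLpNorm_parabolicCylinder_lt_top`
(`RusinSverakLerayStability.lean`): for a suitable weak solution `(u, p)` of the unforced
unit-viscosity Navier–Stokes equations on an open `O ⊆ ℝ × ℝ³` and `z = (t, x) ∈ O`, essential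
boundedness of `u` on one backward cylinder `Q_r(z) = (t - r², t) × B_r(x) ⊆ O` makes `z` a regular
point in the neighbourhood sense (`IsRegularPoint`: `u` essentially bounded on a centred cylinder
`Q*_ρ(z)`). This is the folklore equivalence, at interior times, of the backward-cylinder
convention for regular points (Lemarié-Rieusset 2016, p. 566; Ladyzhenskaya–Seregin) and the
neighbourhood convention (Caffarelli–Kohn–Nirenberg 1982, §6; Robinson–Rodrigo–Sadowski 2016,
Def. 15.1), whose proof is Robinson–Rodrigo–Sadowski's Cor. 15.6, p. 227: apply the one-scale
ε-regularity criterion on cylinders `Q_ρ(x, t + ρ²/8)` whose tops lie in the future of `z`.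

The tree already holds every piece of that proof:

* `isRegularPoint_of_eLpNorm_parabolicCylinder_lt_top_of_unforced` /
  `…_of_pressure_decay` (`RusinSverakBackwardRegularity.lean`): **B** from the pressure decay
  estimate of Seregin–Šverák 2009, (as13) — a theorem, `seregin_sverak_pressure_decay_holds`
  (`PressureDecayEstimateProofs.lean`) — and an unforced one-scale ε-regularity criterion
  (shift of the centre to `(t + h, x)`, iteration of the decay estimate along the scales `θʲ r₀`,
  vanishing of `∫∫ |u|³` over the thin slab `(t, t + h) × B_{r₀}(x)` as `h → 0⁺`, and
  `Q_{s/2}(t + h, x) ⊇ Q*_{√h}(z)`);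
* `isRegularPoint_of_eLpNorm_parabolicCylinder_lt_top_of_theorem15_3`
  (`RusinSverakSingularityStabilityEpsilon.lean`): the one-scale criterion supplied by
  Robinson–Rodrigo–Sadowski's Thm. 15.3 (`RRS2016.theorem15_3`, rescaled from the unit cylinder,
  `RRS2016.theorem15_3.unforced_oneScale`);
* `RRS2016.theorem15_3_holds` (`CKNLocalRegularityRRSPressure.lean`): Thm. 15.3 is now a
  theorem — Steps 1–4 of its proof (`CKNLocalRegularityRRS*.lean`), the cut-off functions of
  Lemma 15.11 (`RRS2016.lemma15_11_holds`), the interpolation inequality of Lemma 15.10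
  (`interpolationEstimate_holds`) and the local pressure estimate of Lemma 15.12
  (`RRS2016.lemma15_12_holds`, Calderón–Zygmund on `L^{3/2}` via Stein's Prop. 3) all being proved.

Composing them gives `isRegularPoint_of_eLpNorm_parabolicCylinder_lt_top_holds`. Kept in a leaf
file: `RusinSverakLerayStability.lean` cannot import its own consumers, and the sibling
`RusinSverakLerayStabilityProofs.lean` (the reduction `K₃ → K`) stays free of the
Caffarelli–Kohn–Nirenberg import cone.

## Mathlib / tree search

Tree (all used): `isRegularPoint_of_eLpNorm_parabolicCylinder_lt_top_of_theorem15_3`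
(`RusinSverakSingularityStabilityEpsilon.lean`), `RRS2016.theorem15_3_holds`
(`CKNLocalRegularityRRSPressure.lean`). `lean search 'isRegularPoint_of_eLpNorm_parabolicCylinder_lt_top_holds'`:
no hits before this file. Mathlib has no Navier–Stokes regularity theory at this pin.

## References

* J. C. Robinson, J. L. Rodrigo, W. Sadowski, *The three-dimensional Navier–Stokes equations*,
  Cambridge Studies in Advanced Mathematics 157 (2016): Def. 15.1, Thm. 15.3 (p. 220), Thm. 15.4
  and the remark after Cor. 15.5, Cor. 15.6 (p. 227), Lemma 15.12 (pp. 232–234).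
  [RobinsonRodrigoSadowski2016]
* W. Rusin, V. Šverák, *Minimal initial data for potential Navier–Stokes singularities*,
  J. Funct. Anal. 260 (2011) 879–891 = arXiv:0911.0500: Prop. 2.1 and the proof of Lemma 2.1
  (p. 4). [RusinSverak2011]
* L. Caffarelli, R. Kohn, L. Nirenberg, *Partial regularity of suitable weak solutions of the
  Navier–Stokes equations*, Comm. Pure Appl. Math. 35 (1982) 771–831: Proposition 1 and
  Corollary, §6 (regular points; shift of the centre). [CaffarelliKohnNirenberg1982]
* G. Seregin, V. Šverák, Comm. PDE 34 (2009) 171–201 = arXiv:0804.1803, proof of Lemma 3.5,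
  (as13). [SereginSverak2009]
-/

noncomputable section

namespace Literature.Analysis.FluidPDE

/-- **Backward-cylinder boundedness makes an interior point regular — the bridge B, proved**
(Robinson–Rodrigo–Sadowski 2016, Cor. 15.6, p. 227: the one-scale criterion Thm. 15.4 applied on
`Q_r(x, t + r²/8) ⊇ Q*_{r/2√2}(x, t)`; here through the accepted reduction
`isRegularPoint_of_eLpNorm_parabolicCylinder_lt_top_of_theorem15_3` — pressure decay estimate
(Seregin–Šverák 2009, (as13), proved) plus the unforced one-scale criterion obtained from
Thm. 15.3 by the Navier–Stokes rescaling — and the discharged Thm. 15.3,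
`RRS2016.theorem15_3_holds`). The named fact **B** of `RusinSverakLerayStability.lean` is thereby
a theorem; its users (`rusin_sverak_leray_singular_points_stable_of_weak_stability` and the
corollaries over it) are fed `isRegularPoint_of_eLpNorm_parabolicCylinder_lt_top_holds`.
[cite: RobinsonRodrigoSadowski2016, Cor. 15.6 p. 227 (with Thm. 15.3 p. 220, Lemma 15.12 pp. 232–234)] -/
theorem isRegularPoint_of_eLpNorm_parabolicCylinder_lt_top_holds :
    isRegularPoint_of_eLpNorm_parabolicCylinder_lt_top :=
  isRegularPoint_of_eLpNorm_parabolicCylinder_lt_top_of_theorem15_3 RRS2016.theorem15_3_holds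

end Literature.Analysis.FluidPDE

end
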